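import Summits.Parity.GeneralizedHardyLittlewood.Theorems.GreenTaoLevelTwoGITwoCyclicInverseSymmetricData

/-!
# Route `GreenTaoLevelTwo`, crux `GITwo` (stmt-Parity-21275), line `birth`, stub `stub_cyclicInverse`:
# C13 assembly, step 3: the small Bohr set `B₄` over `S' = S ∪ F ∪ c·S ∪ {1}` (GT08a §9 Step 3)

Eighty-first helper file toward the XL stub `stub_cyclicInverse` (B. Green, T. Tao, *An inverse
theorem for the Gowers `U³(G)` norm*, arXiv:math/0503014, Thm. 68 = PEMS 51 (2008) Thm. 12.8).
Block C13 (§9 Step 3: "Set `S₃ = S₁ ∪ S₂`", "take a smaller Bohr set `B₄ := B(S₃,ρ₄)`; if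
`h ∈ B₄` then `‖{x,h}‖ ≤ 2^{C₇}η^{−C'₇}ε₄`"): the frequency set used from here on is
`S' = S ∪ F ∪ c·S ∪ {1}` (`F` from arXiv Lemma 46, `c·S` because the halved map is measured against
`½S`, and `1` so that later the Bohr lattice has a unit frequency, `…BohrLattice`); on
`B₄ = B(S',ρ₄)` with `ρ₄` below the thresholds of `exists_symmetric_halved_map`, both hypotheses of
the phase-replacement step `sum_norm_phase_replaced_ge` hold.  Def-free:

* `mem_bohr_union₄` — unpacking membership in `B(S ∪ F ∪ c·S ∪ {1}, r)`;
* `small_bohr_additive`, `small_bohr_antisym_le` — for `x, h ∈ B(S',ρ₄)` (`ρ₄ ≤ 1/8`,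
  `ρ₄ ≤ (κ⁴/8)⁸ρ'/(2³²d)`, `ρ₄ ≤ 1/12`): `μ(x+h) = μ x + μ h` and
  `‖toAddCircle(cμ(x)h − cμ(h)x)‖ ≤ 4·2¹²·d·ρ₄/(ρ₂(κ⁴/8)²)`.

References: [GreenTao2008U3Inverse] arXiv:math/0503014, §9 Step 3.
-/

noncomputable section

namespace Summit.Parity.GeneralizedHardyLittlewood.GreenTaoLevelTwoGITwoCyclicInverse

open Finset ZMod
open Literature.NumberTheory.Sieve

variable {N : ℕ} [NeZero N]

/-- Membership in the Bohr set over `S ∪ F ∪ c·S ∪ {1}`. [folklore] -/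
theorem mem_bohr_union₄ [DecidableEq (ZMod N)] (S F : Finset (ZMod N)) (c : ZMod N) {r : ℝ} {x : ZMod N}
    (hx : x ∈ ({y : ZMod N | ∀ ξ ∈ S ∪ F ∪ S.image (fun ξ => c * ξ) ∪ {1},
      ‖ZMod.toAddCircle (y * ξ)‖ < r} : Finset (ZMod N))) :
    (∀ ξ ∈ S, ‖ZMod.toAddCircle (x * ξ)‖ < r) ∧ (∀ ζ ∈ F, ‖ZMod.toAddCircle (x * ζ)‖ < r) ∧
      (∀ ξ ∈ S, ‖ZMod.toAddCircle (x * (c * ξ))‖ < r) ∧ ‖ZMod.toAddCircle x‖ < r := by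
  rw [mem_filter] at hx
  obtain ⟨-, hx⟩ := hx
  refine ⟨fun ξ hξ => hx ξ (by simp [hξ]), fun ζ hζ => hx ζ (by simp [hζ]),
    fun ξ hξ => hx (c * ξ) ?_, ?_⟩
  · simp only [mem_union, mem_image, mem_singleton]
    exact Or.inl (Or.inr ⟨ξ, hξ, rfl⟩)
  · have := hx 1 (by simp)
    rwa [mul_one] at this

/-- **Additivity on the small Bohr set**: if `μ` is additive on `B(S,¼)` and `ρ₄ ≤ 1/8`, then
`μ(x+h) = μ x + μ h` for `x, h ∈ B(S ∪ F ∪ c·S ∪ {1}, ρ₄)`. [cite: GreenTao2008U3Inverse, §9 Step 3] -/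
theorem small_bohr_additive [DecidableEq (ZMod N)] (S F : Finset (ZMod N)) (c : ZMod N) {ρ₄ : ℝ}
    (hρ₄ : ρ₄ ≤ 1 / 8) {μ : ZMod N → ZMod N}
    (hadd : ∀ h₁ h₂ : ZMod N, (∀ ξ' ∈ S, ‖ZMod.toAddCircle (h₁ * ξ')‖ ≤ 1 / 4) →
      (∀ ξ' ∈ S, ‖ZMod.toAddCircle (h₂ * ξ')‖ ≤ 1 / 4) →
      (∀ ξ' ∈ S, ‖ZMod.toAddCircle ((h₁ + h₂) * ξ')‖ ≤ 1 / 4) → μ (h₁ + h₂) = μ h₁ + μ h₂) :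
    ∀ x ∈ ({y : ZMod N | ∀ ξ ∈ S ∪ F ∪ S.image (fun ξ => c * ξ) ∪ {1},
        ‖ZMod.toAddCircle (y * ξ)‖ < ρ₄} : Finset (ZMod N)),
      ∀ h ∈ ({y : ZMod N | ∀ ξ ∈ S ∪ F ∪ S.image (fun ξ => c * ξ) ∪ {1},
        ‖ZMod.toAddCircle (y * ξ)‖ < ρ₄} : Finset (ZMod N)), μ (x + h) = μ x + μ h := by
  intro x hx h hh
  obtain ⟨hxS, -, -, -⟩ := mem_bohr_union₄ S F c hx
  obtain ⟨hhS, -, -, -⟩ := mem_bohr_union₄ S F c hh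
  refine hadd x h (fun ξ hξ => (hxS ξ hξ).le.trans (by linarith))
    (fun ξ hξ => (hhS ξ hξ).le.trans (by linarith)) (fun ξ hξ => ?_)
  rw [add_mul, map_add]
  calc ‖ZMod.toAddCircle (x * ξ) + ZMod.toAddCircle (h * ξ)‖
      ≤ ‖ZMod.toAddCircle (x * ξ)‖ + ‖ZMod.toAddCircle (h * ξ)‖ := norm_add_le _ _
    _ ≤ ρ₄ + ρ₄ := add_le_add (hxS ξ hξ).le (hhS ξ hξ).le
    _ ≤ 1 / 4 := by linarith

/-- **The antisymmetric form is small on the small Bohr set** (§9 Step 3, "`‖{x,h}‖ ≤ … ε₄`"): with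
the conclusion of `exists_symmetric_halved_map` as hypothesis and
`ρ₄ ≤ min(1/8, (κ⁴/8)⁸ρ'/(2³²d), 1/12)`, for `x, h ∈ B(S ∪ F ∪ c·S ∪ {1}, ρ₄)`:
`‖toAddCircle(cμ(x)h − cμ(h)x)‖ ≤ 4·(2¹² d ρ₄/(ρ₂(κ⁴/8)²))`. [cite: GreenTao2008U3Inverse, §9 Step 3] -/
theorem small_bohr_antisym_le [DecidableEq (ZMod N)] (S F : Finset (ZMod N)) {c : ZMod N}
    (hc : 2 * c = 1) {ρ₂ ρ' ρ₄ κ : ℝ} {μ : ZMod N → ZMod N} (hρ₄0 : 0 < ρ₄) (hρ₄8 : ρ₄ ≤ 1 / 8)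
    (hρ₄z : ρ₄ ≤ (κ ^ 4 / 8) ^ 8 / (2 ^ 32 * (#S : ℝ)) * ρ') (hρ₄F : ρ₄ ≤ 1 / 12)
    (hsym : ∀ (c : ZMod N), 2 * c = 1 → ∀ (t : ℝ), 0 < t → t ≤ 1 / 8 →
        ∀ x : ZMod N, (∀ ξ ∈ S, ‖ZMod.toAddCircle (x * (c * ξ))‖ ≤ t) →
        ∀ z : ZMod N, (∀ ξ ∈ S, ‖ZMod.toAddCircle (z * ξ)‖ <
            (κ ^ 4 / 8) ^ 8 / (2 ^ 32 * (#S : ℝ)) * ρ') →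
          (∀ ζ ∈ F, ‖ZMod.toAddCircle (z * ζ)‖ ≤ 1 / 12) →
            ‖ZMod.toAddCircle (c * μ x * z) - ZMod.toAddCircle (c * μ z * x)‖ ≤
              4 * (2 ^ 12 * (#S : ℝ) * t / (ρ₂ * (κ ^ 4 / 8) ^ 2))) :
    ∀ x ∈ ({y : ZMod N | ∀ ξ ∈ S ∪ F ∪ S.image (fun ξ => c * ξ) ∪ {1},
        ‖ZMod.toAddCircle (y * ξ)‖ < ρ₄} : Finset (ZMod N)),
      ∀ h ∈ ({y : ZMod N | ∀ ξ ∈ S ∪ F ∪ S.image (fun ξ => c * ξ) ∪ {1},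
        ‖ZMod.toAddCircle (y * ξ)‖ < ρ₄} : Finset (ZMod N)),
        ‖ZMod.toAddCircle (c * μ x * h - c * μ h * x)‖ ≤
          4 * (2 ^ 12 * (#S : ℝ) * ρ₄ / (ρ₂ * (κ ^ 4 / 8) ^ 2)) := by
  intro x hx h hh
  obtain ⟨-, -, hxc, -⟩ := mem_bohr_union₄ S F c hx
  obtain ⟨hhS, hhF, -, -⟩ := mem_bohr_union₄ S F c hh
  have h1 := hsym c hc ρ₄ hρ₄0 hρ₄8 x (fun ξ hξ => (hxc ξ hξ).le) h
    (fun ξ hξ => (hhS ξ hξ).trans_le hρ₄z) (fun ζ hζ => (hhF ζ hζ).le.trans hρ₄F)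
  rwa [← map_sub] at h1

end Summit.Parity.GeneralizedHardyLittlewood.GreenTaoLevelTwoGITwoCyclicInverse
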